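import Summits.CriticalPhenomena.PercolationContinuityZ3.Theorems.PercNearOneGluingNoHeavyLowerTailFaceRegimeC
import HarnessLib

/-!
# `NoHeavyLowerTail` (stmt-CriticalPhenomena-4575) — the `2 + star` kernel in REGIME C, observer level

Support file (lemma factory `prim-lf-3` gen 11, seat g11; `--supports stmt-CriticalPhenomena-4575`).  No definitions, no named
facts, no sorries.  Memo: `run/shared/lean/prim/prim-lf-3/LF3-BETA-R.md` §16a.

`kernel_twoPlusStar_regimeC` = `kernel_twoPlusStar_of_formalFace` with its formal-face hypothesis DISCHARGED by `face_regimeC`: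
a one-layer observer `o` with ports `{p₁, p₂} ∪ Q` (any `|Q|`, product law on `Q`), hairs `h₁, h₂ ∈ (0,1)` on `p₁, p₂`, witness `j`;
regime C: the glued pair does not beat `j` (`μ_{K[p₁p₂↦1]}(p₁b) ≤ μ_{K[p₁p₂↦1]}(jb)`) and `p₁` is below `j` and below every port of `Q` in `K`.  Then the split rows of `p₁, p₂` imply Kozma–Nitzan's inequality (41): `μ_W(j ↔ b, o ↔ A) ≤ μ_W(o ↔ b)`.
(Companions: `kernel_twoPlusStar_regimeB`, `kernel_twoPlusStar_regimeD`.)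
-/

namespace Summit.CriticalPhenomena.PercolationContinuityZ3.Theorems

open MeasureTheory Set ProbabilityTheory
open Literature.Probability.LatticeModels
open Literature.Probability.Percolation

noncomputable section
open Classical

namespace UpsetExchange

variable {n : ℕ}

/-- **The `2 + star` kernel in regime C** (observer level).  See the module docstring.
[cite: KozmaNitzan2024, Question 9 (p. 36), Thm. 4–5 and Lemma 5 (pp. 12–14), Lemma 3(i) (p. 6)] -/
theorem kernel_twoPlusStar_regimeC (W : Sym2 (Fin n) → unitInterval) (A Q : Finset (Fin n)) (o p₁ p₂ j b : Fin n)
    (K : Sym2 (Fin n) → unitInterval) (hK : K = fun e => if o ∈ e then 0 else W e)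
    (u : unitInterval) (hu : (u : ℝ) = (W s(o, p₁) : ℝ) * W s(o, p₂))
    (ν : Finset (Fin n) → ℝ) (hν : ∀ Y : Finset (Fin n), ν Y = (∏ q ∈ Y, (W s(o, q) : ℝ)) * ∏ q ∈ Q \ Y, (1 - (W s(o, q) : ℝ)))
    (G : Finset (Fin n) → ℝ)
    (hG : ∀ T : Finset (Fin n), G T =
      (prodBernoulli (fun f : Sym2 (Fin n) => if f ∈ T.image (fun t => s(o, t)) then 1 else K f)).real (openConn o b) -
        (prodBernoulli (fun f : Sym2 (Fin n) => if f ∈ T.image (fun t => s(o, t)) then 1 else K f)).real (openConn j b))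
    (hoA : o ∉ A) (hp₁A : p₁ ∈ A) (hp₂A : p₂ ∈ A) (hQA : Q ⊆ A) (hp₁Q : p₁ ∉ Q) (hp₂Q : p₂ ∉ Q) (hbQ : b ∉ Q) (hp : p₁ ≠ p₂)
    (hjo : j ≠ o) (hbo : b ≠ o)
    (hiso : ∀ u' : Fin n, u' ≠ o → u' ∉ insert p₁ (insert p₂ Q) → W s(o, u') = 0) (hloop : W s(o, o) = 0)
    (hh₁ : 0 < (W s(o, p₁) : ℝ)) (hh₁' : (W s(o, p₁) : ℝ) < 1) (hh₂ : 0 < (W s(o, p₂) : ℝ)) (hh₂' : (W s(o, p₂) : ℝ) < 1)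
    (hB1 : (prodBernoulli (fun f : Sym2 (Fin n) => if f = s(p₁, p₂) then 1 else K f)).real (openConn p₁ b) ≤
      (prodBernoulli (fun f : Sym2 (Fin n) => if f = s(p₁, p₂) then 1 else K f)).real (openConn j b))
    (hp₁j : (prodBernoulli K).real (openConn p₁ b) ≤ (prodBernoulli K).real (openConn j b))
    (hp₁min : ∀ y ∈ Q, (prodBernoulli K).real (openConn p₁ b) ≤ (prodBernoulli K).real (openConn y b))
    (hrow₁ : 0 ≤ ∑ S ∈ Q.powerset, ν S *
      ((1 - (u : ℝ)) * ((prodBernoulli (fun e : Sym2 (Fin n) => if (∀ x ∈ e, x ∈ S) ∧ ¬ e.IsDiag then 1 else K e)).real (openConn p₁ b) -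
          (prodBernoulli (fun e : Sym2 (Fin n) => if (∀ x ∈ e, x ∈ S) ∧ ¬ e.IsDiag then 1 else K e)).real (openConn j b)) +
        (u : ℝ) * ((prodBernoulli (fun f : Sym2 (Fin n) => if f = s(p₁, p₂) then 1 else
              (if (∀ x ∈ f, x ∈ S) ∧ ¬ f.IsDiag then 1 else K f))).real (openConn p₁ b) -
          (prodBernoulli (fun f : Sym2 (Fin n) => if f = s(p₁, p₂) then 1 else
              (if (∀ x ∈ f, x ∈ S) ∧ ¬ f.IsDiag then 1 else K f))).real (openConn j b))))
    (hrow₂ : 0 ≤ ∑ S ∈ Q.powerset, ν S *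
      ((1 - (u : ℝ)) * ((prodBernoulli (fun e : Sym2 (Fin n) => if (∀ x ∈ e, x ∈ S) ∧ ¬ e.IsDiag then 1 else K e)).real (openConn p₂ b) -
          (prodBernoulli (fun e : Sym2 (Fin n) => if (∀ x ∈ e, x ∈ S) ∧ ¬ e.IsDiag then 1 else K e)).real (openConn j b)) +
        (u : ℝ) * ((prodBernoulli (fun f : Sym2 (Fin n) => if f = s(p₂, p₁) then 1 else
              (if (∀ x ∈ f, x ∈ S) ∧ ¬ f.IsDiag then 1 else K f))).real (openConn p₂ b) -
          (prodBernoulli (fun f : Sym2 (Fin n) => if f = s(p₂, p₁) then 1 else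
              (if (∀ x ∈ f, x ∈ S) ∧ ¬ f.IsDiag then 1 else K f))).real (openConn j b)))) :
    (prodBernoulli W).real (openConn j b ∩ ⋃ a ∈ A, openConn o a) ≤ (prodBernoulli W).real (openConn o b) := by
  have hop₁ : o ≠ p₁ := fun h => hoA (h ▸ hp₁A)
  have hop₂ : o ≠ p₂ := fun h => hoA (h ▸ hp₂A)
  have hoQ : o ∉ Q := fun h => hoA (hQA h)
  have hisoK : ∀ u' : Fin n, u' ≠ o → K s(o, u') = 0 := fun u' _ => by rw [hK]; simp
  have hνnn : ∀ S ∈ Q.powerset, 0 ≤ ν S := fun S _ => by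
    rw [hν]
    exact mul_nonneg (Finset.prod_nonneg fun q _ => unitInterval.nonneg _)
      (Finset.prod_nonneg fun q _ => sub_nonneg.2 (unitInterval.le_one _))
  exact kernel_twoPlusStar_of_formalFace W A Q o p₁ p₂ j b K hK u hu ν hν G hG hoA hp₁A hp₂A hQA hp₁Q hp₂Q hp hjo hbo hiso hloop
    hh₁ hh₁' hh₂ hh₂' hrow₁ hrow₂
    (face_regimeC K o p₁ p₂ j b Q ν hνnn u hoQ hp₁Q hp₂Q hbQ hp hop₁ hop₂ hjo hbo hisoK G hG hB1 hp₁j hp₁min hrow₁)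

end UpsetExchange

end

end Summit.CriticalPhenomena.PercolationContinuityZ3.Theorems
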